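import Literature.Analysis.FluidPDE.Tao2016AveragedNS.SeedScaleCorner
import Literature.Analysis.FluidPDE.Tao2016AveragedNS.SeedScaleSharpEntry
import HarnessLib

/-!
# Theorem 5.3 along pseudo-orbits at the SHARP budget, and the seed-scale question at `q = 5`

Note for the FLUID COMPUTER cell (pub-fluidc, blueprint seat bp1). HONEST FRAMING: this is a
low prior, high value-of-information experiment on Tao's machine paradigm
[Tao2016AveragedNS, §5.5]; NOT a claim that NS blows up. Everything here concerns Tao's five-mode
delay circuit `delayCircuitWith K M ε` (an ODE on `ℝ⁵`) and its pseudo-orbits.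

`SeedScaleClosure.lean` decided the cell's typed seed-scale question `PseudoOrbitTransitionSeed q`
(NegativeKickSharp.lean: does every `δ`-pseudo-orbit issued `δ₀`-close to Tao's datum (5.6) with
`δ₀ + δT ≤ ε²e^{-M}/K^q` fire the gate on `[2,T]`?) for every `q ≠ 5` (`↔ 6 ≤ q`), and
`SeedScaleCorner.lean` settled `q = 5` off the corner `64M < K¹⁰`; the corner `K¹⁰/64 ≤ M ≤ K¹⁰`,
where the `q = 5` budget `ε²e^{-M}/K⁵` exceeds the chain's certified firing budget `ε²e^{-M}/(8√M)`,
was left open. This file closes it: the whole seed-scale chain (ignition → entry → transition →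
equipartition → firing → closure over pseudo-orbits) is re-run at the SHARP budget
`δ₀ + δT ≤ (3133/2500)·ε²e^{-M}/√M` of `SeedScaleSharpIgnition.lean` / `SeedScaleSharpEntry.lean`
— any level below the dud threshold `√(π/2)·ε²e^{-M}/√M = 1.25331…` of
`NegativeKickThreshold.lean` — using the weak-budget (`ε²e^{-M}/8`) forms of the transition /
equipartition / firing lemmas (primed names in those files) fed with the sharp entry state
`exists_triggerLevel_hit_sharp`. Since
`ε²e^{-M}/K⁵ ≤ ε²e^{-M}/√M < (3133/2500)·ε²e^{-M}/√M` on the WHOLE family `M ≤ K¹⁰`: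

* `pseudoOrbitTransitionSeed_five : PseudoOrbitTransitionSeed 5` — TRUE, corner included;
* `pseudoOrbitTransitionSeed_iff : PseudoOrbitTransitionSeed q ↔ 5 ≤ q` — the typed seed-scale
  question is now decided for EVERY exponent (NO for `q ≤ 4` by the sharp negative-kick dud
  `not_pseudoOrbitTransitionSeed_of_le_four`, YES for `q ≥ 5` here);
* the same for differentiable approximate trajectories (`approxTrajectoryTransitionSeed_five`).

Quantitatively the dichotomy along pseudo-orbits is now pinned to the dud threshold up to
`2.4·10⁻⁴`: fired on `[2,T]` whenever `δ₀ + δT < 1.2532·ε²e^{-M}/√M` (this file), while the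
pinned negative-kick dud (an exact trajectory, `δ = 0`) with `δ₀ < 1.2535·ε²e^{-M}/√M` never fires
(`exists_negativeKick_dud_pinned`). The fired-state conclusions are packaged in the predicate
`FiredOn K Y S e m` ("on the time set `S`, `|ã - 1| ≤ e/K²⁰` and the other four modes are
`≤ m/K¹⁰`").

Contents: §1 `FiredOn`; §2 the late fired window `[7/4, 2]` and the fired state on `[2,T]` for
differentiable approximate trajectories at the sharp budget; §3 the same along genuine pseudo-orbits
(strict budget, by smoothing); §4 `q = 5` and the `iff`.
-/

noncomputable section

open Real Set MeasureTheory

namespace Literature.Analysis.FluidPDE.Tao2016AveragedNS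

open scoped NNReal

/-! ## §1. The fired state on a set of times -/

/-- **Fired on `S`.** The trajectory `Y : ℝ → ℝ⁵` of (a pseudo-orbit of) Tao's delay circuit is in
the FIRED state on the time set `S` with tolerances `(e, m)`: the output mode satisfies
`|ã(t) - 1| ≤ e` and the four other modes `|a|, |b|, |c|, |d| ≤ m` for every `t ∈ S` — the
conclusion of [Tao2016AveragedNS, Theorem 5.3] ("almost all the energy has moved to `ã`").
[cite: Tao2016AveragedNS, §5.5 Theorem 5.3] -/
def FiredOn (K : ℝ) (Y : ℝ → Fin 5 → ℝ) (S : Set ℝ) (e m : ℝ) : Prop :=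
  ∀ t ∈ S, |Y t 4 - 1| ≤ e / K ^ 20 ∧ ∀ i : Fin 5, i ≠ 4 → |Y t i| ≤ m / K ^ 10

/-- Monotonicity of `FiredOn` in the time set. [folklore] -/
theorem FiredOn.mono {K : ℝ} {Y : ℝ → Fin 5 → ℝ} {S S' : Set ℝ} {e m : ℝ}
    (h : FiredOn K Y S e m) (hS : S' ⊆ S) : FiredOn K Y S' e m :=
  fun t ht => h t (hS ht)

/-! ## §2. Differentiable approximate trajectories at the sharp budget -/

section Approx

/-- **The gate fires along every differentiable approximate trajectory within the SHARP budget.**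
For every member `delayCircuitWith K M ε` under the standing hypotheses and every differentiable
approximate trajectory `Y` (velocity `V`, sup-defect `≤ δ` and sup-norm `≤ 2` on `[0,T)`, `T ≥ 2`)
issued `δ₀`-close to (5.6) with `δ₀ + δT ≤ (3133/2500)·ε²e^{-M}/√M`: the trajectory is in the fired
state `|ã - 1| ≤ 4K⁻²⁰`, `|a|, |b|, |c|, |d| ≤ 2K⁻¹⁰` at every `t ∈ [7/4, 2]` (sharp entry state
`exists_triggerLevel_hit_sharp`, then the weak-budget transition/equipartition/firing lemmas
`Ignition.fired_after'`; `t = 2` by continuity). [cite: Tao2016AveragedNS, §5.5 Theorem 5.3] -/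
theorem approxTrajectory_firedOn_late_sharp (K M ε δ δ₀ T : ℝ) (Y V : ℝ → Fin 5 → ℝ)
    (hK : 2 * 20 ^ 42 * (Nat.factorial 42 : ℝ) + 16 ≤ K) (hML : 3000 * Real.log K ≤ M)
    (hMK : M ≤ K ^ 10) (hε : 0 < ε) (hεle : ε ≤ exp (-(10 * M)) / K ^ 100) (hT : 2 ≤ T)
    (hY : ∀ t, HasDerivAt Y (V t) t)
    (hV : ∀ t ∈ Ico 0 T, ‖V t - delayCircuitWith K M ε (Y t)‖ ≤ δ)
    (hR : ∀ t ∈ Ico 0 T, ‖Y t‖ ≤ 2) (h0 : ‖Y 0 - delayInit‖ ≤ δ₀)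
    (hB : δ₀ + δ * T ≤ 3133 / 2500 * (ε ^ 2 * exp (-M)) / Real.sqrt M) :
    FiredOn K Y (Icc (7 / 4) 2) 4 2 := by
  have hδ : 0 ≤ δ := Ignition.defect_nonneg hV hT
  have hηS : δ₀ + 2 * δ ≤ 3133 / 2500 * (ε ^ 2 * exp (-M)) / Real.sqrt M := by nlinarith
  have hη : δ₀ + 2 * δ ≤ ε ^ 2 * exp (-M) / 8 :=
    hηS.trans (IgnitionSharp.sharp_level_le_eighth hK hML hMK hε hεle)
  obtain ⟨τ, hτ, hcτ, -, -, hblate, -⟩ :=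
    IgnitionSharp.exists_triggerLevel_hit_sharp hY hV hR hT hK hML hMK hε hεle h0 hηS
  have hbτ : 49 / 50 * ε ≤ Y τ 1 := hblate τ ⟨hτ.1.le, le_rfl⟩
  obtain ⟨-, hon, hd0, hd20⟩ := Ignition.transition_params hK hML hMK hε hεle
  obtain ⟨-, -, -, -, hs20, hKinv, -, -⟩ :=
    Ignition.firing_params' hV hT hK hML hMK hε hεle h0 hη
  have hK16 := (negKick_params hK hML hMK hε hεle).1
  have hsq0 := (Thm53.invSqrt_facts hK16).1
  have hfit2 : τ + 130 * Real.log K / M + K⁻¹ + (Real.sqrt K)⁻¹ < 7 / 4 := by linarith [hτ.2]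
  -- the open part `[7/4, 2)`: the firing lemma on the late window `[0, t]`
  have hIco : ∀ t ∈ Ico (7 / 4 : ℝ) 2,
      |Y t 4 - 1| ≤ 4 / K ^ 20 ∧ ∀ i : Fin 5, i ≠ 4 → |Y t i| ≤ 2 / K ^ 10 := by
    intro t ht
    exact Ignition.fired_after' hY hV hR hT (T' := t) (by linarith [ht.2]) ht.2.le hK hML hMK hε
      hεle h0 hη hτ.1 hcτ hbτ hd0 hon (by linarith [ht.1, hsq0]) ⟨by linarith [ht.1], le_rfl⟩
  intro t ht
  rcases lt_or_eq_of_le ht.2 with h2 | h2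
  · exact hIco t ⟨ht.1, h2⟩
  · subst h2
    have h74 : (7 / 4 : ℝ) < 2 := by norm_num
    refine ⟨?_, fun i hi => ?_⟩
    · exact Ignition.le_at_two_of_Ico
        (((Ignition.continuous_coord hY 4).sub continuous_const).abs) h74
        (fun s hs => (hIco s hs).1)
    · exact Ignition.le_at_two_of_Ico ((Ignition.continuous_coord hY i).abs) h74
        (fun s hs => (hIco s hs).2 i hi)

set_option maxHeartbeats 400000 in
/-- **The fired state from the cycle time `2` onwards, SHARP budget.** Under the hypotheses of
`approxTrajectory_firedOn_late_sharp`: `|ã - 1| ≤ 6K⁻²⁰` and `|a|, |b|, |c|, |d| ≤ 4K⁻¹⁰` at every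
`t ∈ [2, T]`
(almost-monotone output `ã' ≥ -δ`, almost-conserved energy, `δ₀ + δT ≤ ε² ≤ K⁻²⁰/40`; the end
point by continuity). [cite: Tao2016AveragedNS, §5.5 Theorem 5.3] -/
theorem approxTrajectory_firedOn_from_two_sharp (K M ε δ δ₀ T : ℝ) (Y V : ℝ → Fin 5 → ℝ)
    (hK : 2 * 20 ^ 42 * (Nat.factorial 42 : ℝ) + 16 ≤ K) (hML : 3000 * Real.log K ≤ M)
    (hMK : M ≤ K ^ 10) (hε : 0 < ε) (hεle : ε ≤ exp (-(10 * M)) / K ^ 100) (hT : 2 ≤ T)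
    (hY : ∀ t, HasDerivAt Y (V t) t)
    (hV : ∀ t ∈ Ico 0 T, ‖V t - delayCircuitWith K M ε (Y t)‖ ≤ δ)
    (hR : ∀ t ∈ Ico 0 T, ‖Y t‖ ≤ 2) (h0 : ‖Y 0 - delayInit‖ ≤ δ₀)
    (hB : δ₀ + δ * T ≤ 3133 / 2500 * (ε ^ 2 * exp (-M)) / Real.sqrt M) :
    FiredOn K Y (Icc 2 T) 6 4 := by
  have hδ : 0 ≤ δ := Ignition.defect_nonneg hV hT
  have hδ₀ : 0 ≤ δ₀ := (norm_nonneg _).trans h0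
  have hηS : δ₀ + 2 * δ ≤ 3133 / 2500 * (ε ^ 2 * exp (-M)) / Real.sqrt M := by nlinarith
  have hη : δ₀ + 2 * δ ≤ ε ^ 2 * exp (-M) / 8 :=
    hηS.trans (IgnitionSharp.sharp_level_le_eighth hK hML hMK hε hεle)
  obtain ⟨-, -, -, hδ₀1, -, -⟩ := Ignition.budget_facts' hV hT hK hML hMK hε hεle h0 hη
  obtain ⟨hε100, -, -, -, -, -, -, -⟩ := Ignition.firing_params' hV hT hK hML hMK hε hεle h0 hη
  obtain ⟨hM6000, hε1, -, -, hMε, -, -, h77, -⟩ := Ignition.ignition_params hK hML hMK hε hεle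
  obtain ⟨hK16, -, -, -, -, -⟩ := negKick_params hK hML hMK hε hεle
  have hK0 : (0 : ℝ) < K := by linarith
  have hK1 : (1 : ℝ) ≤ K := by linarith
  -- the budget is below `ε²`, and `40ε² ≤ 1/K²⁰`
  have hbud : δ₀ + δ * T ≤ ε ^ 2 := by
    refine hB.trans ?_
    have hsq0 : (0 : ℝ) < Real.sqrt M := by linarith
    rw [div_le_iff₀ hsq0]
    have hexp : exp (-M) ≤ 1 := by rw [exp_le_one_iff]; linarith
    have h1 : ε ^ 2 * exp (-M) ≤ ε ^ 2 * 1 := mul_le_mul_of_nonneg_left hexp (sq_nonneg ε)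
    nlinarith [sq_nonneg ε]
  have hK20 : 1 / K ^ 100 ≤ 1 / K ^ 20 :=
    one_div_le_one_div_of_le (by positivity) (pow_le_pow_right₀ hK1 (by norm_num))
  have h40ε : 40 * ε ^ 2 ≤ 1 / K ^ 20 := by
    have h1 : 40 * ε ≤ 1 := by nlinarith
    have h2 : 40 * ε ^ 2 ≤ ε := by nlinarith
    exact h2.trans (hε100.trans hK20)
  have hε2 : ε ^ 2 ≤ 1 / K ^ 20 := by nlinarith [sq_nonneg ε]
  have hK20s : 1 / K ^ 20 ≤ 1 / 16 :=
    one_div_le_one_div_of_le (by norm_num) (le_trans hK16 (le_self_pow₀ hK1 (by norm_num)))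
  have r4 : (4 : ℝ) / K ^ 20 = 4 * (1 / K ^ 20) := by ring
  have r6 : (6 : ℝ) / K ^ 20 = 6 * (1 / K ^ 20) := by ring
  -- the fired state at `t = 2`
  obtain ⟨he2, hi2⟩ := approxTrajectory_firedOn_late_sharp K M ε δ δ₀ T Y V hK hML hMK hε hεle hT
    hY hV hR h0 hB 2 ⟨by norm_num, le_rfl⟩
  rw [r4] at he2
  -- the bounds on `[2, T)`
  have key : ∀ t ∈ Ico 2 T,
      |Y t 4 - 1| ≤ 6 / K ^ 20 ∧ ∀ i : Fin 5, i ≠ 4 → |Y t i| ≤ 4 / K ^ 10 := by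
    intro t ht
    have ht0T : t ∈ Ico 0 T := ⟨by linarith [ht.1], ht.2⟩
    -- almost-monotone output
    have hmono : Y 2 4 - δ * (t - 2) ≤ Y t 4 :=
      Ignition.e_sub_ge_late hY hV ht.2 hK0.le (by norm_num) ht.1 le_rfl
    have hδt : δ * (t - 2) ≤ ε ^ 2 := by
      have : δ * (t - 2) ≤ δ * T := mul_le_mul_of_nonneg_left (by linarith [ht.2]) hδ
      linarith
    have he_lo : 1 - 4 * (1 / K ^ 20) - ε ^ 2 ≤ Y t 4 := by linarith [(abs_le.1 he2).1]
    -- almost-conserved energy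
    have hE := Ignition.abs_energy_sub_le hY hV hR ht0T
    have hE0 := Ignition.abs_energy_init_le h0 hδ₀1
    have h20 : 20 * δ * t ≤ 20 * (δ * T) := by nlinarith [ht.2]
    have hEt : energy (Y t) ≤ 1 + 20 * ε ^ 2 := by
      linarith [(abs_le.1 hE).2, (abs_le.1 hE0).2]
    have he_sq := Ignition.sq_le_energy (Y t) 4
    have he_hi : Y t 4 - 1 ≤ 20 * ε ^ 2 := by
      by_cases h1 : 1 ≤ Y t 4
      · have hid : (Y t 4 - 1) * (Y t 4 + 1) = Y t 4 ^ 2 - 1 := by ring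
        have hprod : (Y t 4 - 1) * (Y t 4 + 1) ≤ 20 * ε ^ 2 := by rw [hid]; linarith
        calc Y t 4 - 1 = (Y t 4 - 1) * 1 := by ring
          _ ≤ (Y t 4 - 1) * (Y t 4 + 1) := mul_le_mul_of_nonneg_left (by linarith) (by linarith)
          _ ≤ 20 * ε ^ 2 := hprod
      · linarith [sq_nonneg ε]
    refine ⟨?_, fun i hi => ?_⟩
    · rw [r6, abs_le]
      constructor <;> linarith
    · -- the other modes carry at most `energy - ã²`
      have hsum := Ignition.sq_add_sq_le_energy (Y t) hi
      have hμ0 : 0 ≤ 1 - 4 * (1 / K ^ 20) - ε ^ 2 := by linarith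
      have hesq : (1 - 4 * (1 / K ^ 20) - ε ^ 2) ^ 2 ≤ Y t 4 ^ 2 := pow_le_pow_left₀ hμ0 he_lo 2
      have hexp2 : 1 - 2 * (4 * (1 / K ^ 20) + ε ^ 2) ≤ (1 - 4 * (1 / K ^ 20) - ε ^ 2) ^ 2 := by
        nlinarith [sq_nonneg (4 * (1 / K ^ 20) + ε ^ 2)]
      have hsq : Y t i ^ 2 ≤ (4 / K ^ 10) ^ 2 := by
        have r16 : ((4 : ℝ) / K ^ 10) ^ 2 = 16 * (1 / K ^ 20) := by ring
        rw [r16]; linarith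
      exact abs_le_of_sq_le_sq hsq (by positivity)
  -- the end point `t = T` by continuity
  intro t ht
  by_cases htT : t < T
  · exact key t ⟨ht.1, htT⟩
  have htT' : t = T := le_antisymm ht.2 (not_lt.1 htT)
  rcases eq_or_lt_of_le hT with h2T | h2T
  · have ht2 : t = 2 := by rw [htT', ← h2T]
    subst ht2
    refine ⟨?_, fun i hi => (hi2 i hi).trans ?_⟩
    · have hK20pos : (0 : ℝ) ≤ 1 / K ^ 20 := by positivity
      rw [r6]; linarith
    · exact div_le_div_of_nonneg_right (by norm_num) (by positivity)
  · rw [htT']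
    refine ⟨?_, fun i hi => ?_⟩
    · exact Ignition.le_at_right_of_Ico (g := fun s => |Y s 4 - 1|)
        (((Ignition.continuous_coord hY 4).sub continuous_const).abs) h2T fun s hs => (key s hs).1
    · exact Ignition.le_at_right_of_Ico (g := fun s => |Y s i|)
        ((Ignition.continuous_coord hY i).abs) h2T fun s hs => (key s hs).2 i hi

end Approx

/-! ## §3. Genuine pseudo-orbits at the sharp budget -/

section Member

variable {K M ε δ δ₀ T : ℝ} {Y : ℝ → Fin 5 → ℝ}

/-- **Theorem 5.3 along every pseudo-orbit within the SHARP budget (open form).** Let `Y` be a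
`δ`-pseudo-orbit of a member `delayCircuitWith K M ε` in the sup-ball of radius `2` on `[0,T]`
(`T ≥ 2`; continuous on `[0,T]`, RIGHT-differentiable on `[0,T)`), issued `δ₀`-close to (5.6), with
`δ₀ + δT < (3133/2500)·ε²e^{-M}/√M` (strict). Then the gate is FIRED on all of `[2,T]`:
`|ã - 1| ≤ 6K⁻²⁰` and `|a|, |b|, |c|, |d| ≤ 4K⁻¹⁰` (WLOG `Y` globally continuous; for `η → 0` the
smoothing lemma gives differentiable approximate trajectories within the sharp budget, to which
`approxTrajectory_firedOn_from_two_sharp` applies; the conclusion is closed).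
[cite: Tao2016AveragedNS, §5.5 Theorem 5.3] -/
theorem IsPseudoOrbit.firedOn_from_two_sharp (hY : IsPseudoOrbit (delayCircuitWith K M ε) δ 2 T Y)
    (hK : 2 * 20 ^ 42 * (Nat.factorial 42 : ℝ) + 16 ≤ K) (hML : 3000 * Real.log K ≤ M)
    (hMK : M ≤ K ^ 10) (hε : 0 < ε) (hεle : ε ≤ exp (-(10 * M)) / K ^ 100) (hT : 2 ≤ T)
    (h0 : ‖Y 0 - delayInit‖ ≤ δ₀)
    (hB : δ₀ + δ * T < 3133 / 2500 * (ε ^ 2 * exp (-M)) / Real.sqrt M) :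
    FiredOn K Y (Icc 2 T) 6 4 := by
  -- parameter facts
  obtain ⟨-, hε1, hε2, hexpM, -, -, -, h77, -⟩ := Ignition.ignition_params hK hML hMK hε hεle
  have hT0 : 0 < T := by linarith
  have hδ : 0 ≤ δ := by
    obtain ⟨V, -, hV⟩ := hY.defect 0 ⟨le_rfl, hT0⟩
    exact (norm_nonneg _).trans hV
  have hδ₀ : 0 ≤ δ₀ := (norm_nonneg _).trans h0
  have hδT : 0 ≤ δ * T := by positivity
  have hs0 : 0 < ε ^ 2 * exp (-M) := by positivity
  have hb8 : 3133 / 2500 * (ε ^ 2 * exp (-M)) / Real.sqrt M ≤ 1 / 100 := by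
    have hsq0 : (0 : ℝ) < Real.sqrt M := by linarith
    rw [div_le_iff₀ hsq0]
    have h2 : ε ^ 2 * exp (-M) ≤ 1 / 100000 * (1 / 1000000) :=
      mul_le_mul hε2 hexpM (exp_pos _).le (by norm_num)
    nlinarith
  -- WLOG `Y` is globally continuous
  obtain ⟨Yc, hYcc, hYcY, hYc⟩ := hY.exists_continuous hT0.le
  have h0c : ‖Yc 0 - delayInit‖ ≤ δ₀ := by rw [hYcY ⟨le_rfl, hT0.le⟩]; exact h0
  have hR₀ : ∀ t ∈ Icc 0 T, ‖Yc t‖ ≤ 6 / 5 :=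
    hYc.norm_le_six_fifths hδ h0c (by linarith) (by linarith)
  have hF : Continuous (delayCircuitWith K M ε) := continuous_delayCircuitWith K M ε
  -- the slack
  obtain ⟨η₀, hη₀⟩ : ∃ η₀ : ℝ,
      η₀ = (3133 / 2500 * (ε ^ 2 * exp (-M)) / Real.sqrt M - (δ₀ + δ * T)) / (1 + T) := ⟨_, rfl⟩
  have hη₀pos : 0 < η₀ := by rw [hη₀]; exact div_pos (by linarith) (by linarith)
  have hη₀T : η₀ * (1 + T) = 3133 / 2500 * (ε ^ 2 * exp (-M)) / Real.sqrt M - (δ₀ + δ * T) := by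
    rw [hη₀]; field_simp
  intro t ht
  have htT : t ∈ Icc 0 T := ⟨by linarith [ht.1], ht.2⟩
  -- the bounds with an extra `η`, for every `η > 0`
  have key : ∀ η : ℝ, 0 < η →
      |Yc t 4 - 1| ≤ 6 / K ^ 20 + η ∧ ∀ i : Fin 5, i ≠ 4 → |Yc t i| ≤ 4 / K ^ 10 + η := by
    intro η hη
    obtain ⟨η', hη'⟩ : ∃ η' : ℝ, η' = min η (min η₀ (1 / 2)) := ⟨_, rfl⟩
    have hη'0 : 0 < η' := by rw [hη']; exact lt_min hη (lt_min hη₀pos (by norm_num))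
    have hη'η : η' ≤ η := by rw [hη']; exact min_le_left _ _
    have hη'η₀ : η' ≤ η₀ := by rw [hη']; exact (min_le_right _ _).trans (min_le_left _ _)
    have hη'2 : η' ≤ 1 / 2 := by rw [hη']; exact (min_le_right _ _).trans (min_le_right _ _)
    obtain ⟨Z, W, hZd, hWd, hZn, hZY⟩ := hYc.exists_smooth_approx hF hYcc hT0 hR₀ hη'0
    have hR : ∀ s ∈ Ico 0 T, ‖Z s‖ ≤ 2 := fun s hs =>
      (hZn s ⟨hs.1, hs.2.le⟩).trans (by linarith)
    have h0' : ‖Z 0 - delayInit‖ ≤ δ₀ + η' := by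
      calc ‖Z 0 - delayInit‖ = ‖(Z 0 - Yc 0) + (Yc 0 - delayInit)‖ := by rw [sub_add_sub_cancel]
        _ ≤ ‖Z 0 - Yc 0‖ + ‖Yc 0 - delayInit‖ := norm_add_le _ _
        _ ≤ δ₀ + η' := by linarith [hZY 0 ⟨le_rfl, hT0.le⟩]
    have hB' : (δ₀ + η') + (δ + η') * T ≤ 3133 / 2500 * (ε ^ 2 * exp (-M)) / Real.sqrt M := by
      have h1 : η' * (1 + T) ≤ η₀ * (1 + T) := mul_le_mul_of_nonneg_right hη'η₀ (by linarith)
      nlinarith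
    obtain ⟨he, hi⟩ := approxTrajectory_firedOn_from_two_sharp K M ε (δ + η') (δ₀ + η') T Z W hK
      hML hMK hε hεle hT hZd hWd hR h0' hB' t ht
    have hcoord : ∀ i, |Z t i - Yc t i| ≤ η' := fun i => by
      have h1 := norm_le_pi_norm (Z t - Yc t) i
      rw [Pi.sub_apply, Real.norm_eq_abs] at h1
      exact h1.trans (hZY t htT)
    refine ⟨?_, fun i hi4 => ?_⟩
    · have h1 := abs_le.1 (hcoord 4)
      have h2 := abs_le.1 he
      rw [abs_le]; constructor <;> linarith
    · have h1 := abs_le.1 (hcoord i)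
      have h2 := abs_le.1 (hi i hi4)
      rw [abs_le]; constructor <;> linarith
  rw [← hYcY htT]
  exact ⟨le_of_forall_pos_le_add fun η hη => (key η hη).1,
    fun i hi => le_of_forall_pos_le_add fun η hη => (key η hη).2 i hi⟩

/-- **Theorem 5.3 along pseudo-orbits under the `q = 5` budget, corner included.** Every
`δ`-pseudo-orbit in the sup-ball of radius `2` on `[0,T]` (`T ≥ 2`) of a member (`M ≤ K¹⁰`) issued
`δ₀`-close to (5.6) with `δ₀ + δT ≤ ε²e^{-M}/K⁵` is fired on `[2,T]` (`ε²e^{-M}/K⁵ ≤ ε²e^{-M}/√M <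
(3133/2500)·ε²e^{-M}/√M`). [cite: Tao2016AveragedNS, §5.5 Theorem 5.3] -/
theorem IsPseudoOrbit.firedOn_from_two_pow_five
    (hY : IsPseudoOrbit (delayCircuitWith K M ε) δ 2 T Y)
    (hK : 2 * 20 ^ 42 * (Nat.factorial 42 : ℝ) + 16 ≤ K) (hML : 3000 * Real.log K ≤ M)
    (hMK : M ≤ K ^ 10) (hε : 0 < ε) (hεle : ε ≤ exp (-(10 * M)) / K ^ 100) (hT : 2 ≤ T)
    (h0 : ‖Y 0 - delayInit‖ ≤ δ₀) (hB : δ₀ + δ * T ≤ ε ^ 2 * exp (-M) / K ^ 5) :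
    FiredOn K Y (Icc 2 T) 6 4 := by
  refine hY.firedOn_from_two_sharp hK hML hMK hε hεle hT h0 (hB.trans_lt ?_)
  obtain ⟨hK16, hM4, -⟩ := negKick_params hK hML hMK hε hεle
  have hM0 : 0 < M := by linarith
  have hsq0 : 0 < Real.sqrt M := Real.sqrt_pos.2 hM0
  have hs : 0 < ε ^ 2 * exp (-M) := by positivity
  have hsqK : Real.sqrt M ≤ K ^ 5 := by
    rw [Real.sqrt_le_left (by positivity)]
    calc M ≤ K ^ 10 := hMK
      _ = (K ^ 5) ^ 2 := by ring
  calc ε ^ 2 * exp (-M) / K ^ 5 ≤ ε ^ 2 * exp (-M) / Real.sqrt M :=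
        div_le_div_of_nonneg_left hs.le hsq0 hsqK
    _ = 1 * (ε ^ 2 * exp (-M)) / Real.sqrt M := by ring
    _ < 3133 / 2500 * (ε ^ 2 * exp (-M)) / Real.sqrt M := by gcongr; norm_num

end Member

/-! ## §4. The seed-scale question at `q = 5`, and for every exponent -/

/-- **The cell's seed-scale question holds at `q = 5` for pseudo-orbits, on the whole family.** For
every member of the retuned family (`M ≤ K¹⁰`, the corner `K¹⁰/64 ≤ M` of SeedScaleCorner.lean
included) and every `δ`-pseudo-orbit in the sup-ball of radius `2` on `[0,T]` (`T ≥ 2`) issued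
`δ₀`-close to (5.6) with `δ₀ + δT ≤ ε²e^{-M}/K⁵`, the gate is fired with tolerance `1/4` at every
`t ∈ [2,T]`. [cite: Tao2016AveragedNS, §5.5 Theorem 5.3] -/
theorem pseudoOrbitTransitionSeed_five : PseudoOrbitTransitionSeed 5 := by
  intro K M ε δ δ₀ T Y hK hML hMK hε hεle hT hδ₀ hδ hY h0 hB t ht
  obtain ⟨hK16, -, -, -, -, -⟩ := negKick_params hK hML hMK hε hεle
  have hK1 : (1 : ℝ) ≤ K := by linarith
  have h20 : (256 : ℝ) ≤ K ^ 20 :=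
    le_trans (by nlinarith) (pow_le_pow_right₀ hK1 (by norm_num : 2 ≤ 20))
  have h10 : (16 : ℝ) ≤ K ^ 10 := le_trans hK16 (le_self_pow₀ hK1 (by norm_num))
  have h6 : (6 : ℝ) / K ^ 20 ≤ 1 / 4 := by rw [div_le_iff₀ (by positivity)]; linarith
  have h4 : (4 : ℝ) / K ^ 10 ≤ 1 / 4 := by rw [div_le_iff₀ (by positivity)]; linarith
  obtain ⟨he, hi⟩ := hY.firedOn_from_two_pow_five hK hML hMK hε hεle hT h0 hB t ht
  exact ⟨he.trans h6, fun i hi' => (hi i hi').trans h4⟩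

/-- **The seed-scale question is decided for every exponent**: `PseudoOrbitTransitionSeed q ↔ 5 ≤ q`
(NO for `q ≤ 4` by the sharp negative-kick dud `not_pseudoOrbitTransitionSeed_of_le_four`, YES for
`q ≥ 5` by Theorem 5.3 along pseudo-orbits at the sharp budget). Together with
`ignition_threshold_pinned` / `exists_negativeKick_dud_pinned` the dichotomy along pseudo-orbits is
located at the dud threshold `√(π/2)·ε²e^{-M}/√M` up to a relative `2.4·10⁻⁴`.
[cite: Tao2016AveragedNS, §5.5 Theorem 5.3] -/
theorem pseudoOrbitTransitionSeed_iff {q : ℕ} : PseudoOrbitTransitionSeed q ↔ 5 ≤ q := by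
  constructor
  · intro h
    by_contra hlt
    exact not_pseudoOrbitTransitionSeed_of_le_four (q := q) (by omega) h
  · exact fun hq => pseudoOrbitTransitionSeed_five.mono hq

/-- **The differentiable form at `q = 5`** (`ApproxTrajectoryTransitionSeed`, SeedScaleTiming.lean);
every `q ≥ 5` follows by `ApproxTrajectoryTransitionSeed.mono`, every `q ≥ 5` for pseudo-orbits by
`PseudoOrbitTransitionSeed.mono`. [cite: Tao2016AveragedNS, §5.5 Theorem 5.3] -/
theorem approxTrajectoryTransitionSeed_five : ApproxTrajectoryTransitionSeed 5 :=
  pseudoOrbitTransitionSeed_five.approx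

end Literature.Analysis.FluidPDE.Tao2016AveragedNS
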